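import Literature.Barriers.ValiantsHypothesis.FullRankMultilinearCoeff
import Literature.Barriers.ValiantsHypothesis.FullRankMultilinearFamily
import HarnessLib

/-!
# Proof of Raz–Yehudayoff 2008, Theorem 4.2 (the polynomial `f` is of full rank)

Discharges the named fact `Literature.Barriers.ValiantsHypothesis.RazYehudayoff2008_thm42` of
`FullRankMultilinear.lean`: for every field `F`, every `n` and every partition
`A : Fin (2n) ≃ Fin n ⊕ Fin n` the partial derivative matrix of `f^A`, `f = f_{1,2n}` the
Raz–Yehudayoff polynomial viewed in `K[X]`, `K = F(W)`, has full rank `2^n`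
[RazYehudayoff2008, Thm. 4.2].

**Proof architecture** (the printed proof, [RazYehudayoff2008, §4.3.1], made effective).
The source proves Lemma 4.3 — for every interval `[i, j]` of length `2m` balanced on `A`,
`Rank(M_{f_{i,j}^A}) = 2^m` — by induction on `m`, in two cases: *Case one* (no balanced proper
even prefix): the sign argument gives `A(x_i)`, `A(x_j)` on different sides and `[i+1, j-1]`
balanced, `M_{(1 + A(x_i)A(x_j)) f_{i+1,j-1}} = M_{1 + yz} ⊗ M_{f_{i+1,j-1}}` has rank `2 · 2^{m-1}`, and
substituting `ω_{i,ℓ,j} = 0` shows `Rank(M_{f_{i,j}})` is at least that; *Case two* (a balanced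
prefix `[i, ℓ₀]`): `M_{f_{i,ℓ₀} f_{ℓ₀+1,j}}` is a Kronecker product of two full-rank matrices and
`ω_{i,ℓ₀,j}` does not occur elsewhere. Both "does not occur" steps are specialisation arguments;
we run them as follows (`RazYehudayoff.core`): over an arbitrary infinite field `S` and for the
family `f^{c}` with *specialised* coefficients `c i ℓ j ∈ S` in place of `ω_{i,ℓ,j}`
(`RazYehudayoff.ryFc`), we construct by induction on `m` a coefficient assignment `c` (level by
level: at a Case-one interval all `c i ℓ j = 0`; at a Case-two interval `c i ℓ₀ j = γ` with `γ`
from `FullRk.exists_add_C_mul` and the other `c i ℓ j = 0`) such that every balanced interval of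
length `≤ 2m` has a full-rank coefficient matrix (`FullRk`, column-injectivity form). Since the
determinant of the coefficient matrix of the universal polynomial (coefficients in `F[W]`)
specialises to the determinant for `f^{c}` under `ω ↦ c` (`map_ryFc`, `det_cM_map_rename`), it is
a non-zero element of `F[W]`, hence non-zero in `K = F(W)`, so `M_{f^A}` is invertible over `K`
and has rank `2^n` (`RazYehudayoff2008_thm42_holds`).

## References
* [RazYehudayoff2008] R. Raz, A. Yehudayoff, *Balancing syntactically multilinear arithmetic
  circuits*, Comput. Complexity 17 (2008) 515–535, §4.1, §4.2.2, Thm. 4.2, Lemma 4.3, §4.3.1.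
-/

noncomputable section

namespace Literature.Barriers.ValiantsHypothesis

namespace RazYehudayoff

open MvPolynomial

/-! ### Lemma 4.3 with specialised coefficients -/

section Core

variable (S : Type*) [Field S] [Infinite S] (N : ℕ) (col : Fin N → Bool)

/-- **[RazYehudayoff2008, Lemma 4.3], effective form.** Over an infinite field `S` and for a
colouring `col` of the positions `[0, N)` there are coefficients `c` such that for every
balanced interval `[i, i+len)` of even length `len ≤ 2m` the coefficient matrix of
`f^{c}_{[i, i+len)}` with respect to its `Y`- and `Z`-positions has full rank `2^{len/2}`.
[cite: RazYehudayoff2008, Lemma 4.3 and §4.3.1] -/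
theorem core (m : ℕ) :
    ∃ c : ℕ → ℕ → ℕ → S, ∀ len i fuel, len ≤ 2 * m → Even len → i + len ≤ N →
      Dd col i len = 0 → len ≤ 2 * fuel →
        FullRk (ryFc S N c fuel len i) (YI col i len) (ZI col i len) := by
  induction m with
  | zero =>
    refine ⟨fun _ _ _ => 0, ?_⟩
    intro len i fuel hlen _ _ _ _
    obtain rfl : len = 0 := by omega
    simpa using (fullRk_one : FullRk (1 : MvPolynomial (Fin N) S) ∅ ∅)
  | succ m ih =>
    obtain ⟨c, hc⟩ := ih
    classical
    set L := 2 * m + 2 with hL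
    -- a balanced proper even prefix of `[i, i+L)`
    let pre : ℕ → ℕ → Prop := fun i a => 2 ≤ a ∧ a + 2 ≤ L ∧ Even a ∧ Dd col i a = 0
    let a₀ : ℕ → ℕ := fun i => if h : ∃ a, pre i a then Nat.find h else 0
    let H : ℕ → MvPolynomial (Fin N) S := fun i =>
      (1 + xv S N i * xv S N (i + L - 1)) * ryFc S N c m (2 * m) (i + 1)
    let P : ℕ → MvPolynomial (Fin N) S := fun i =>
      ryFc S N c m (a₀ i) i * ryFc S N c m (L - a₀ i) (i + a₀ i)
    let γ : ℕ → S := fun i =>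
      Classical.epsilon fun γ : S => FullRk (H i + C γ * P i) (YI col i L) (ZI col i L)
    let c' : ℕ → ℕ → ℕ → S := fun i l j =>
      if j + 1 = i + L then (if (∃ a, pre i a) ∧ l + 1 = i + a₀ i then γ i else 0) else c i l j
    refine ⟨c', ?_⟩
    intro len i fuel hlen heven hiN hbal hfuel
    -- below the top level `c'` agrees with `c`
    have hlow : ∀ len' i', len' ≤ 2 * m + 1 → ∀ fuel',
        ryFc S N c' fuel' len' i' = ryFc S N c fuel' len' i' := by
      intro len' i' hlen' fuel'
      apply ryFc_congr
      intro i'' l j'' h1 h2 h3 h4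
      simp only [c']
      rw [if_neg (by omega)]
    rcases (show len ≤ 2 * m ∨ len = L by rcases heven with ⟨r, hr⟩; omega) with hle | rfl
    · rw [hlow len i (by omega)]
      exact hc len i fuel hle heven hiN hbal hfuel
    · -- the top level `len = L = 2m + 2`
      obtain ⟨f, rfl⟩ : ∃ f, fuel = f + 1 := ⟨fuel - 1, by omega⟩
      have hi : i < N := by omega
      have hj : i + L - 1 < N := by omega
      have hexp : ryFc S N c' (f + 1) L i = H i +
          ∑ a ∈ (Finset.range (L - 1)).filter (fun a => Even a ∧ 2 ≤ a),
            C (c' i (i + a - 1) (i + L - 1)) *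
              (ryFc S N c m a i * ryFc S N c m (L - a) (i + a)) := by
        rw [ryFc_succ c' (by omega : L ≠ 0)]
        congr 1
        · show _ = (1 + xv S N i * xv S N (i + L - 1)) * ryFc S N c m (2 * m) (i + 1)
          rw [hlow (L - 2) (i + 1) (by omega) f, show L - 2 = 2 * m by omega,
            ryFc_stable c (fuel := f) (fuel' := m) (len := 2 * m) (by omega) (by omega) (i + 1)]
        · refine Finset.sum_congr rfl fun a ha => ?_
          simp only [Finset.mem_filter, Finset.mem_range] at ha
          rw [mul_assoc, hlow a i (by omega) f, hlow (L - a) (i + a) (by omega) f,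
            ryFc_stable c (fuel := f) (fuel' := m) (len := a) (by omega) (by omega) i,
            ryFc_stable c (fuel := f) (fuel' := m) (len := L - a) (by omega) (by omega) (i + a)]
      have hcoef : ∀ a, 2 ≤ a → c' i (i + a - 1) (i + L - 1) =
          if (∃ a, pre i a) ∧ a = a₀ i then γ i else 0 := by
        intro a ha
        simp only [c']
        rw [if_pos (by omega)]
        by_cases hx : (∃ a, pre i a) ∧ a = a₀ i
        · rw [if_pos hx, if_pos ⟨hx.1, by omega⟩]
        · rw [if_neg hx, if_neg (fun h => hx ⟨h.1, by omega⟩)]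
      by_cases hpre : ∃ a, pre i a
      · -- Case two of the source: a balanced proper prefix `[i, i + a₀)`
        have ha₀ : pre i (a₀ i) := by
          simp only [a₀]
          rw [dif_pos hpre]
          exact Nat.find_spec hpre
        obtain ⟨ha2, haL, haev, habal⟩ := ha₀
        have hsum : ∑ a ∈ (Finset.range (L - 1)).filter (fun a => Even a ∧ 2 ≤ a),
            C (c' i (i + a - 1) (i + L - 1)) *
              (ryFc S N c m a i * ryFc S N c m (L - a) (i + a)) = C (γ i) * P i := by
          rw [Finset.sum_eq_single (a₀ i)]
          · rw [hcoef _ ha2, if_pos ⟨hpre, rfl⟩]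
          · intro b hb hne
            simp only [Finset.mem_filter, Finset.mem_range] at hb
            rw [hcoef _ hb.2.2, if_neg (fun h => hne h.2), C_0, zero_mul]
          · intro hnot
            exfalso
            apply hnot
            simp only [Finset.mem_filter, Finset.mem_range]
            exact ⟨by omega, haev, ha2⟩
        rw [hexp, hsum]
        have hP : FullRk (P i) (YI col i L) (ZI col i L) := by
          have h₁ := hc (a₀ i) i m (by omega) haev (by omega) habal (by omega)
          have hbal2 : Dd col (i + a₀ i) (L - a₀ i) = 0 := by
            have := Dd_split col (i := i) (len := L) (a := a₀ i) (by omega)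
            rw [hbal, habal] at this
            linarith
          have hev2 : Even (L - a₀ i) := (Nat.even_sub (by omega)).2 (iff_of_true heven haev)
          have h₂ := hc (L - a₀ i) (i + a₀ i) m (by omega) hev2 (by omega) hbal2 (by omega)
          rw [YI_split col (i := i) (len := L) (a := a₀ i) (by omega),
            ZI_split col (i := i) (len := L) (a := a₀ i) (by omega)]
          exact FullRk.mul (Iv_disjoint (i := i) (a := a₀ i) (j := i + a₀ i) (b := L - a₀ i) le_rfl)
            (ryFc_mem_supported c m (a₀ i) i) (ryFc_mem_supported c m (L - a₀ i) (i + a₀ i))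
            (YI_subset_Iv col _ _) (ZI_subset_Iv col _ _) (YI_subset_Iv col _ _)
            (ZI_subset_Iv col _ _) h₁ h₂
        obtain ⟨γ₀, hγ₀⟩ := FullRk.exists_add_C_mul (card_YI_eq_card_ZI col hbal) hP (H i)
        exact Classical.epsilon_spec
          (p := fun γ : S => FullRk (H i + C γ * P i) (YI col i L) (ZI col i L)) ⟨γ₀, hγ₀⟩
      · -- Case one of the source: no balanced proper even prefix
        have hsum : ∑ a ∈ (Finset.range (L - 1)).filter (fun a => Even a ∧ 2 ≤ a),
            C (c' i (i + a - 1) (i + L - 1)) *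
              (ryFc S N c m a i * ryFc S N c m (L - a) (i + a)) = 0 := by
          refine Finset.sum_eq_zero fun a ha => ?_
          simp only [Finset.mem_filter, Finset.mem_range] at ha
          rw [hcoef _ ha.2.2, if_neg (fun h => hpre h.1), C_0, zero_mul]
        rw [hexp, hsum, add_zero]
        have hno : ∀ a, 2 ≤ a → a + 2 ≤ L → Even a → Dd col i a ≠ 0 :=
          fun a h1 h2 h3 h4 => hpre ⟨a, h1, h2, h3, h4⟩
        obtain ⟨hcol, hbal'⟩ := caseOne col (i := i) (len := L) (by omega) heven hiN hbal hno
        rw [show L - 2 = 2 * m by omega] at hbal'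
        have h₂ := hc (2 * m) (i + 1) m le_rfl (even_two_mul m) (by omega) hbal' le_rfl
        show FullRk ((1 + xv S N i * xv S N (i + L - 1)) * ryFc S N c m (2 * m) (i + 1))
          (YI col i L) (ZI col i L)
        rw [YI_ends col (by omega : 2 ≤ L), ZI_ends col (by omega : 2 ≤ L),
          show L - 2 = 2 * m by omega, xv_of_lt hi, xv_of_lt hj]
        have hne : (⟨i, hi⟩ : Fin N) ≠ ⟨i + L - 1, hj⟩ :=
          Fin.ne_of_val_ne (by show i ≠ i + L - 1; omega)
        refine FullRk.mul (W₁ := Iv N i 1 ∪ Iv N (i + L - 1) 1) (W₂ := Iv N (i + 1) (2 * m))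
          ?_ ?_ (ryFc_mem_supported c m (2 * m) (i + 1)) ?_ ?_ (YI_subset_Iv col _ _)
          (ZI_subset_Iv col _ _) ?_ h₂
        · rw [Finset.disjoint_left]
          intro k hk hk'
          simp only [Finset.mem_union, mem_Iv] at hk hk'
          omega
        · refine Subalgebra.add_mem _ (Subalgebra.one_mem _) (Subalgebra.mul_mem _ ?_ ?_)
          · rw [← xv_of_lt hi]
            refine xv_mem_supported _ fun hk => ?_
            simp only [Finset.mem_union, mem_Iv]
            omega
          · rw [← xv_of_lt hj]
            refine xv_mem_supported _ fun hk => ?_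
            simp only [Finset.mem_union, mem_Iv]
            omega
        · rw [Iv_one hi, Iv_one hj]
          exact Finset.union_subset_union (YI_subset_Iv col _ _ |>.trans (by rw [Iv_one hi]))
            (YI_subset_Iv col _ _ |>.trans (by rw [Iv_one hj]))
        · rw [Iv_one hi, Iv_one hj]
          exact Finset.union_subset_union (ZI_subset_Iv col _ _ |>.trans (by rw [Iv_one hi]))
            (ZI_subset_Iv col _ _ |>.trans (by rw [Iv_one hj]))
        · -- "`Rank(M_{1 + A(x_i) A(x_j)}) = 2`"
          by_cases hci : col ⟨i, hi⟩ = true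
          · have hcj : col ⟨i + L - 1, hj⟩ = false :=
              Bool.of_not_eq_true fun h => hcol (hci.trans h.symm)
            rw [YI_one_of_eq_true col hi hci, YI_one_of_eq_false col hj hcj,
              ZI_one_of_eq_true col hi hci, ZI_one_of_eq_false col hj hcj, Finset.union_empty,
              Finset.empty_union]
            exact fullRk_one_add_X_mul_X hne
          · have hci' : col ⟨i, hi⟩ = false := Bool.of_not_eq_true hci
            have hcj : col ⟨i + L - 1, hj⟩ = true := by
              by_contra h
              exact hcol (hci'.trans (Bool.of_not_eq_true h).symm)
            rw [YI_one_of_eq_false col hi hci', YI_one_of_eq_true col hj hcj,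
              ZI_one_of_eq_false col hi hci', ZI_one_of_eq_true col hj hcj, Finset.union_empty,
              Finset.empty_union, mul_comm (X _) (X _)]
            exact fullRk_one_add_X_mul_X hne.symm

/-- All balanced even-length intervals at once (take `m` large). [cite: RazYehudayoff2008, Lemma 4.3] -/
theorem core_all :
    ∃ c : ℕ → ℕ → ℕ → S, ∀ len i fuel, Even len → i + len ≤ N → Dd col i len = 0 →
      len ≤ 2 * fuel → FullRk (ryFc S N c fuel len i) (YI col i len) (ZI col i len) := by
  obtain ⟨c, hc⟩ := core S N col N
  exact ⟨c, fun len i fuel h1 h2 h3 h4 => hc len i fuel (by omega) h1 h2 h3 h4⟩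

end Core

/-! ### From a partition `A` to the colouring, and the top-level matrix -/

section Partition

variable {n : ℕ} (A : Fin (2 * n) ≃ Fin n ⊕ Fin n)

/-- The colouring of the positions defined by a partition: `true` = "`A(x_k) ∈ Y`". [cite: RazYehudayoff2008, §4.2.1] -/
def colOf : Fin (2 * n) → Bool := fun k => (A k).isLeft

/-- The position of `y_t`. [cite: RazYehudayoff2008, §4.2.1] -/
def eY : Fin n ↪ Fin (2 * n) :=
  ⟨fun y => A.symm (Sum.inl y), fun _ _ h => Sum.inl_injective (A.symm.injective h)⟩

/-- The position of `z_t`. [cite: RazYehudayoff2008, §4.2.1] -/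
def eZ : Fin n ↪ Fin (2 * n) :=
  ⟨fun z => A.symm (Sum.inr z), fun _ _ h => Sum.inr_injective (A.symm.injective h)⟩

/-- Unfolding `eY`. [folklore] -/
@[simp] theorem eY_apply (y : Fin n) : eY A y = A.symm (Sum.inl y) := rfl

/-- Unfolding `eZ`. [folklore] -/
@[simp] theorem eZ_apply (z : Fin n) : eZ A z = A.symm (Sum.inr z) := rfl

/-- The `Y`-positions of the whole interval are the positions of `y_1, …, y_n`. [folklore] -/
theorem YI_colOf : YI (colOf A) 0 (2 * n) = Finset.univ.map (eY A) := by
  ext k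
  simp only [mem_YI, Finset.mem_map, Finset.mem_univ, true_and, colOf, zero_le, zero_add,
    k.2, and_true, eY_apply]
  constructor
  · intro hk
    obtain ⟨y, hy⟩ := Sum.isLeft_iff.1 hk
    exact ⟨y, by rw [← hy, Equiv.symm_apply_apply]⟩
  · rintro ⟨y, rfl⟩
    simp

/-- The `Z`-positions of the whole interval are the positions of `z_1, …, z_n`. [folklore] -/
theorem ZI_colOf : ZI (colOf A) 0 (2 * n) = Finset.univ.map (eZ A) := by
  ext k
  simp only [mem_ZI, Finset.mem_map, Finset.mem_univ, true_and, colOf, zero_le, zero_add,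
    k.2, and_true, eZ_apply, Sum.isLeft_eq_false]
  constructor
  · intro hk
    obtain ⟨z, hz⟩ := Sum.isRight_iff.1 hk
    exact ⟨z, by rw [← hz, Equiv.symm_apply_apply]⟩
  · rintro ⟨z, rfl⟩
    simp

/-- The whole interval `[1, 2n]` is balanced. [cite: RazYehudayoff2008, §4.3 (proof of Thm. 4.2)] -/
theorem Dd_colOf : Dd (colOf A) 0 (2 * n) = 0 := by
  simp [Dd, YI_colOf, ZI_colOf]

/-- The coefficient matrix `M_g` of `g ∈ R[Y ⊔ Z]` over any commutative semiring (the tree's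
`pdMatrix` for fields). [cite: RazYehudayoff2008, §4.2.2] -/
def cM {R : Type*} [CommSemiring R] {m : ℕ} (g : MvPolynomial (Fin m ⊕ Fin m) R) :
    Matrix (Finset (Fin m)) (Finset (Fin m)) R :=
  Matrix.of fun U T => coeff (setMonomial U T) g

/-- `pdMatrix = cM` over a field. [folklore] -/
theorem pdMatrix_eq_cM {K : Type*} [Field K] {m : ℕ} (g : MvPolynomial (Fin m ⊕ Fin m) K) :
    pdMatrix g = cM g := rfl

/-- Ring maps on the coefficients act entrywise on `M_g`. [folklore] -/
theorem cM_map {R₁ R₂ : Type*} [CommSemiring R₁] [CommSemiring R₂] (φ : R₁ →+* R₂) {m : ℕ}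
    (g : MvPolynomial (Fin m ⊕ Fin m) R₁) : cM (MvPolynomial.map φ g) = (cM g).map φ := by
  ext U T
  simp [cM, coeff_map]

/-- **Specialisation of the determinant**: `det M_{(φ_* g)^A} = φ (det M_{g^A})`. [folklore] -/
theorem det_cM_map_rename {R₁ R₂ : Type*} [CommRing R₁] [CommRing R₂] (φ : R₁ →+* R₂)
    (g : MvPolynomial (Fin (2 * n)) R₁) :
    (cM (rename A (MvPolynomial.map φ g))).det = φ (cM (rename A g)).det := by
  rw [← map_rename, cM_map, ← RingHom.mapMatrix_apply, ← RingHom.map_det]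

/-- The entries of `M_{g^A}` are the coefficients of `g` at the pulled-back monomials.
[cite: RazYehudayoff2008, §4.2.1–4.2.2] -/
theorem coeff_setMonomial_rename {R : Type*} [CommSemiring R] (g : MvPolynomial (Fin (2 * n)) R)
    (U T : Finset (Fin n)) :
    coeff (setMonomial U T) (rename A g) = coeff (ind (U.map (eY A) ∪ T.map (eZ A))) g := by
  have hdisj : Disjoint (U.map (eY A)) (T.map (eZ A)) := by
    rw [Finset.disjoint_left]
    intro k hk hk'
    obtain ⟨y, -, rfl⟩ := Finset.mem_map.1 hk
    obtain ⟨z, -, hz⟩ := Finset.mem_map.1 hk'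
    exact Sum.inr_ne_inl (A.symm.injective (hz : A.symm (Sum.inr z) = A.symm (Sum.inl y)))
  have hmap : setMonomial U T = (ind (U.map (eY A) ∪ T.map (eZ A))).mapDomain A := by
    unfold setMonomial
    rw [ind_union hdisj, Finsupp.mapDomain_add, ind, ind, Finsupp.mapDomain_finsetSum,
      Finsupp.mapDomain_finsetSum, Finset.sum_map, Finset.sum_map]
    simp only [Finsupp.mapDomain_single, eY_apply, eZ_apply, Equiv.apply_symm_apply]
  rw [hmap, coeff_rename_mapDomain A A.injective]

/-- **From `FullRk` to the matrix**: full rank with respect to all `Y`- and `Z`-positions makes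
`M_{g^A}` injective on column vectors. [folklore] -/
theorem injective_mulVec_cM {R : Type*} [CommRing R] (g : MvPolynomial (Fin (2 * n)) R)
    (h : FullRk g (Finset.univ.map (eY A)) (Finset.univ.map (eZ A))) :
    Function.Injective (cM (rename A g)).mulVec := by
  intro v w hvw
  rw [← sub_eq_zero]
  have hd : (cM (rename A g)).mulVec (v - w) = 0 := by rw [Matrix.mulVec_sub, hvw, sub_self]
  let back : Finset (Fin (2 * n)) → Finset (Fin n) := fun V' =>
    Finset.univ.filter fun t => eZ A t ∈ V'
  have hback : ∀ T : Finset (Fin n), back (T.map (eZ A)) = T := by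
    intro T
    ext t
    simp [back]
  let u : Finset (Fin (2 * n)) → R := fun V' => (v - w) (back V')
  have hu : ∀ V', V' ⊆ Finset.univ.map (eZ A) → u V' = 0 := by
    refine h u fun U' hU' => ?_
    obtain ⟨U, rfl⟩ : ∃ U : Finset (Fin n), U' = U.map (eY A) := by
      refine ⟨Finset.univ.filter fun y => eY A y ∈ U', ?_⟩
      ext k
      simp only [Finset.mem_map, Finset.mem_filter, Finset.mem_univ, true_and]
      constructor
      · intro hk
        obtain ⟨y, -, rfl⟩ := Finset.mem_map.1 (hU' hk)
        exact ⟨y, hk, rfl⟩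
      · rintro ⟨y, hy, rfl⟩
        exact hy
    have hsum : ∑ V' ∈ (Finset.univ.map (eZ A)).powerset,
        coeff (ind (U.map (eY A) ∪ V')) g * u V' =
          ∑ T : Finset (Fin n), coeff (ind (U.map (eY A) ∪ T.map (eZ A))) g * u (T.map (eZ A)) := by
      symm
      refine Finset.sum_nbij' (fun T => T.map (eZ A)) back ?_ ?_ ?_ ?_ (fun _ _ => rfl)
      · intro T _
        exact Finset.mem_powerset.2 (Finset.map_subset_map.2 (Finset.subset_univ T))
      · intro V' _
        exact Finset.mem_univ _
      · intro T _
        exact hback T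
      · intro V' hV'
        rw [Finset.mem_powerset] at hV'
        ext k
        simp only [Finset.mem_map, back, Finset.mem_filter, Finset.mem_univ, true_and]
        constructor
        · rintro ⟨t, ht, rfl⟩
          exact ht
        · intro hk
          obtain ⟨t, -, rfl⟩ := Finset.mem_map.1 (hV' hk)
          exact ⟨t, hk, rfl⟩
    rw [hsum]
    have happ := congr_fun hd U
    rw [Pi.zero_apply] at happ
    rw [← happ]
    simp only [Matrix.mulVec, dotProduct, cM, Matrix.of_apply]
    refine Finset.sum_congr rfl fun T _ => ?_
    rw [coeff_setMonomial_rename]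
    simp only [u, hback]
  funext T
  have := hu (T.map (eZ A)) (Finset.map_subset_map.2 (Finset.subset_univ T))
  simp only [u, hback] at this
  exact this

end Partition

end RazYehudayoff

/-! ### Theorem 4.2 -/

universe u

open MvPolynomial RazYehudayoff in
/-- **Raz–Yehudayoff 2008, Thm. 4.2 (proved).** "Let `G = F(W)` be the field of rational
functions over the field `F` and over the set of variables `W`. Let `f ∈ G[X]` be the polynomial
defined in Section 4.1. Then `f` is of full rank (over the field `G`)": for every field `F`,
every `n` and every partition `A` of `{x_1, …, x_{2n}}` into `Y`, `Z` with `|Y| = |Z| = n`, the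
`2^n × 2^n` partial derivative matrix of `f^A` has rank `2^n`. Discharges the named fact
`RazYehudayoff2008_thm42`. [cite: RazYehudayoff2008, Thm. 4.2 and Lemma 4.3] -/
theorem RazYehudayoff2008_thm42_holds : RazYehudayoff2008_thm42.{u} := by
  intro F _ n A
  classical
  have hdet : (pdMatrix (rename A (razYehudayoffPolyK F n))).det ≠ 0 := by
    intro h0
    rw [razYehudayoffPolyK_eq, pdMatrix_eq_cM, det_cM_map_rename] at h0
    set gR := ryFc (MvPolynomial (RYAux (2 * n)) F) (2 * n) (wPoly F (2 * n)) (n + 1) (2 * n) 0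
      with hgR
    -- `det M` is already `0` in `F[W]`
    have h2 := (IsFractionRing.injective (MvPolynomial (RYAux (2 * n)) F) (RYField F n))
      (h0.trans (map_zero _).symm)
    -- specialise `ω ↦ c` into the infinite field `S = F(t)`
    haveI : Infinite (FractionRing (Polynomial F)) :=
      Infinite.of_injective _ (IsFractionRing.injective (Polynomial F) (FractionRing (Polynomial F)))
    obtain ⟨c, hc⟩ := core_all (FractionRing (Polynomial F)) (2 * n) (colOf A)
    let φ : MvPolynomial (RYAux (2 * n)) F →+* FractionRing (Polynomial F) :=
      eval₂Hom ((algebraMap (Polynomial F) (FractionRing (Polynomial F))).comp Polynomial.C)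
        (fun w => c w.1 w.2.1 w.2.2)
    have h3 : (cM (rename A (MvPolynomial.map φ gR))).det = 0 := by
      rw [det_cM_map_rename, h2, map_zero]
    have h4 : MvPolynomial.map φ gR = ryFc (FractionRing (Polynomial F)) (2 * n) c (n + 1) (2 * n) 0 := by
      rw [hgR, map_ryFc]
      apply ryFc_congr
      intro i' l j' _ _ _ hj'
      have hi' : i' < 2 * n := by omega
      have hl : l < 2 * n := by omega
      have hj'' : j' < 2 * n := by omega
      show φ (wPoly F (2 * n) i' l j') = c i' l j'
      simp only [wPoly, dif_pos (show i' < 2 * n ∧ l < 2 * n ∧ j' < 2 * n from ⟨hi', hl, hj''⟩)]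
      simp [φ]
    rw [h4] at h3
    have h5 := hc (2 * n) 0 (n + 1) (even_two_mul n) (by omega) (Dd_colOf A) (by omega)
    rw [YI_colOf, ZI_colOf] at h5
    have h6 := Matrix.mulVec_injective_iff_isUnit.1 (injective_mulVec_cM A _ h5)
    rw [Matrix.isUnit_iff_isUnit_det, isUnit_iff_ne_zero] at h6
    exact h6 h3
  have hU : IsUnit (pdMatrix (rename A (razYehudayoffPolyK F n))) :=
    (Matrix.isUnit_iff_isUnit_det _).2 (isUnit_iff_ne_zero.2 hdet)
  rw [Matrix.rank_of_isUnit _ hU, Fintype.card_finset, Fintype.card_fin]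

end Literature.Barriers.ValiantsHypothesis
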